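import Summits.AtomisticToContinuum.Crystallization.Theorems.ThreeConeCertificateSlackRigidityPricedFloorsIncrIdent2
import Summits.AtomisticToContinuum.Crystallization.Theorems.ThreeConeCertificateSlackRigidityPricedFloorsIncrIdent3
import Summits.AtomisticToContinuum.Crystallization.Theorems.ThreeConeCertificateSlackRigidityPricedFloorsMeasurability2
import HarnessLib

/-!
# `SlackRigidity` (stmt-AtomisticToContinuum-11960), line `priced-floors-palm-exactification`, stub S3
# (`stub_layeredMeanSelection`), package (II): increment functionals, part 4 — the measurable
# functionals of the sample

Lead c19, worker package (II), part 4 (assembly).  `lms_exists_increment_functionals` (registered):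
given the presentation relation `REL` between any two normal-form data fitting the same set, there
are Giry-measurable, globally bounded functionals `D` and, for every window size `n`, `A, B, V, Dt`
of measures on `ℝ³` which on every rooted `δ`-separated sample `count|S` fitted by data `e` take the
values `DE e`, `AE n e`, `BE n e`, `VE n e`, `DtE n e` of the inline data functionals of parts 1–3
(the inputs of the mean increment argument `lms_increments_ae_zero'`).

Construction (`exists_measurable_functional`): a data functional `ψ` continuous on the (compact)
normal-form data has closed super-level sets there, so the joint measurability theorem
`Measurability.lms_measurable_dataSup_joint` (with a dummy space point) produces a measurable
`F` on `Measure E3 × E3` with `F (count|S, y) = sup {ψ e | e fits S}`; the supremum is the common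
value `ψ e` by `REL`-invariance (`lms_functionals_rel`, `dataSup_eq_of_forall_eq`), and clamping
to the a-priori range (`lms_AB_bounds`, `lms_jump_functional_bounds`) keeps measurability and the
identification.  All `[folklore]`.
-/

noncomputable section

open MeasureTheory Filter Set
open scoped BigOperators Topology

namespace Summit.AtomisticToContinuum.Crystallization.Theorems.SlackRigidityPricedFloorsIncrIdent

open Literature.Probability.Process
open Literature.MathematicalPhysics.StatisticalMechanics
open Summit.AtomisticToContinuum.Crystallization.Theorems.SlackRigidityPricedFloors

/-! ## From a continuous invariant data functional to a measurable functional of the sample -/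

/-- **Measurable selection of an invariant data functional.**  A data functional `ψ`, continuous on
the normal-form data, taking one value on all data fitting a given set, and with values in
`[lo, hi]` on normal data, is represented by a measurable functional `F` of measures with values in
`[lo, hi]` and `F (count|S) = ψ e` for every rooted `δ`-separated `S` fitted by `e`. [folklore] -/
theorem exists_measurable_functional {δ : ℝ} [Fact (0 < δ)] (ψ : LData → ℝ)
    (hψ : ContinuousOn ψ {e : LData | IsNormalData e})
    (hinv : ∀ (S : Set E3) (e e' : LData), Fits S e → Fits S e' → ψ e' = ψ e)
    {lo hi : ℝ} (hlh : lo ≤ hi) (hb : ∀ e : LData, IsNormalData e → lo ≤ ψ e ∧ ψ e ≤ hi) :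
    ∃ F : Measure E3 → ℝ, Measurable F ∧ (∀ μ : Measure E3, lo ≤ F μ ∧ F μ ≤ hi) ∧
      ∀ (S : Set E3) (e : LData), (0 : E3) ∈ S → (∀ x ∈ S, ∀ y ∈ S, x ≠ y → δ ≤ dist x y) →
        Fits S e → F ((Measure.count : Measure E3).restrict S) = ψ e := by
  have hcont : Continuous fun x : {e : LData // IsNormalData e} × E3 => ψ x.1.1 :=
    (continuousOn_iff_continuous_restrict.1 hψ).comp continuous_fst
  have hclosed : ∀ c : ℝ, IsClosed {x : {e : LData // IsNormalData e} × E3 |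
      c ≤ (fun p : LData × E3 => ψ p.1) (x.1.1, x.2)} :=
    fun c => isClosed_le continuous_const hcont
  obtain ⟨F₂, hF₂m, hF₂⟩ :=
    (SlackRigidityPricedFloorsMeasurability.lms_measurable_dataSup_joint δ (fun p : LData × E3 => ψ p.1)
      hclosed).2
  refine ⟨fun μ => max lo (min hi (F₂ (μ, 0))), ?_,
    fun μ => ⟨le_max_left _ _, max_le hlh (min_le_left _ _)⟩, ?_⟩
  · exact measurable_const.max (measurable_const.min (hF₂m.comp (measurable_id.prodMk measurable_const)))
  · intro S e h0 hsep he
    let Sc : LocalConfig.RootedHardCoreConfig E3 δ := ⟨LocalConfig.mk S, h0, hsep⟩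
    have h1 : F₂ ((Measure.count : Measure E3).restrict S, 0) = dataSup ψ S := hF₂ Sc 0
    have h2 : dataSup ψ S = ψ e := dataSup_eq_of_forall_eq he (fun e' he' => hinv S e e' he he')
    show max lo (min hi (F₂ ((Measure.count : Measure E3).restrict S, 0))) = ψ e
    rw [h1, h2, min_eq_right (hb e he.1).2, max_eq_right (hb e he.1).1]

/-! ## (II5) The increment functionals -/

/-- **The increment functionals of the sample** (registered sub-goal
`lms_exists_increment_functionals`): see the module docstring. [folklore] -/
theorem lms_exists_increment_functionals : ∀ (δ : ℝ), 0 < δ → (∀ (S : Set E3) (e e' : LData), Fits S e → Fits S e' → (e'.2.1 = e.2.1 ∧ ((e'.2.2.2 = e.2.2.2 ∧ (e'.2.2.1 = e.2.2.1 ∨ e'.2.2.1 = fun m => -e.2.2.1 m)) ∨ (e'.2.2.2 = (fun m => -e.2.2.2 (-m)) ∧ (e'.2.2.1 = (fun m => e.2.2.1 (-m - 1)) ∨ e'.2.2.1 = fun m => -e.2.2.1 (-m - 1)))))) → ∃ K₀ : ℝ, 0 ≤ K₀ ∧ ∃ D : Measure E3 → ℝ, Measurable D ∧ (∀ μ : Measure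 E3, 0 ≤ D μ ∧ D μ ≤ K₀) ∧ (∀ (S : Set E3) (e : LData), (0 : E3) ∈ S → (∀ x ∈ S, ∀ y ∈ S, x ≠ y → δ ≤ dist x y) → Fits S e → D ((Measure.count : Measure E3).restrict S) = ((e.2.2.2 1 - e.2.2.2 0) - (e.2.2.2 2 - e.2.2.2 1)) ^ 2 + ((e.2.2.2 (-1) - e.2.2.2 (-2)) - (e.2.2.2 0 - e.2.2.2 (-1))) ^ 2) ∧ ∀ n : ℕ, ∃ A B V Dt : Measure E3 → ℝ, Measurable A ∧ Measurable B ∧ Measurable V ∧ Measurable Dt ∧ (∀ μ : Measure E3, |A μ| ≤ K₀) ∧ (∀ μ : Measure E3, |B μ| ≤ K₀) ∧ (∀ μ : Measure E3, 0 ≤ V μ ∧ V μ ≤ K₀) ∧ (∀ μ : Measure E3, 0 ≤ Dt μ ∧ Dt μ ≤ K₀) ∧ ∀ (S : Set E3) (e : LData), (0 : E3) ∈ S → (∀ x ∈ S, ∀ y ∈ S, x ≠ y → δ ≤ dist x y) → Fits S e → A ((Measure.count : Measure E3).restrict S) = ((1 / (2 * (n : ℝ) + 1)) * ∑ m ∈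 Finset.Icc (-(n : ℤ)) n, (inLayerInteraction lennardJones e.2.1 + ∑' m' : ℤ, if m' = m then (0 : ℝ) else layerInteraction lennardJones e.2.1 (e.2.2.2 m' - e.2.2.2 m) (haggLabel e.2.2.1 m' - haggLabel e.2.2.1 m) 1)) ∧ B ((Measure.count : Measure E3).restrict S) = (∑ m ∈ Finset.Icc (-((n + 1 : ℕ) : ℤ)) ((n + 1 : ℕ) : ℤ), ((1 / (2 * (2 * (n : ℝ) + 1))) * ((if m ∈ Finset.Icc (-(n : ℤ) + 1) ((n : ℤ) + 1) then (1 : ℝ) else 0) + (if m ∈ Finset.Icc (-(n : ℤ) - 1) ((n : ℤ) - 1) then (1 : ℝ) else 0))) * (inLayerInteraction lennardJones e.2.1 + ∑' m' : ℤ, if m' = m then (0 : ℝ) else layerInteraction lennardJones e.2.1 (e.2.2.2 m' - e.2.2.2 m) (haggLabel e.2.2.1 m' - haggLabel e.2.2.1 m) 1)) ∧ V ((Measure.count : Measure E3).restrict S) = ((1 / (2 * (n : ℝ) + 1)) * (∑ l ∈ Finset.range (2 * n), ((e.2.2.2 ((-(n : ℤ) + l) + 1) - e.2.2.2 (-(n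 : ℤ) + l)) - (e.2.2.2 ((-(n : ℤ) + l) + 2) - e.2.2.2 ((-(n : ℤ) + l) + 1))) ^ 2 + ∑ l ∈ Finset.range (2 * n), ((e.2.2.2 ((-(n : ℤ) - 1 + l) + 1) - e.2.2.2 (-(n : ℤ) - 1 + l)) - (e.2.2.2 ((-(n : ℤ) - 1 + l) + 2) - e.2.2.2 ((-(n : ℤ) - 1 + l) + 1))) ^ 2)) ∧ Dt ((Measure.count : Measure E3).restrict S) = ((1 / (2 * (n : ℝ) + 1)) * ∑ m ∈ Finset.Icc (-(n : ℤ)) n, (((e.2.2.2 (m + 1) - e.2.2.2 m) - (e.2.2.2 (m + 2) - e.2.2.2 (m + 1))) ^ 2 + ((e.2.2.2 (m - 1) - e.2.2.2 (m - 2)) - (e.2.2.2 m - e.2.2.2 (m - 1))) ^ 2)) := by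
  intro δ hδ hrel
  haveI : Fact (0 < δ) := ⟨hδ⟩
  obtain ⟨K, hK0, hK⟩ := lms_AB_bounds
  have hK1 : (1 : ℝ) ≤ max K 1 := le_max_right _ _
  have hKK : K ≤ max K 1 := le_max_left _ _
  have hrel' := fun (S : Set E3) (e e' : LData) (he : Fits S e) (he' : Fits S e') =>
    lms_functionals_rel e e' (hrel S e e' he he')
  -- D
  obtain ⟨D, hDm, hDb, hDid⟩ := exists_measurable_functional (δ := δ) (fun e : LData => ((e.2.2.2 1 - e.2.2.2 0) - (e.2.2.2 2 - e.2.2.2 1)) ^ 2 + ((e.2.2.2 (-1) - e.2.2.2 (-2)) - (e.2.2.2 0 - e.2.2.2 (-1))) ^ 2)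
    (Continuous.continuousOn (by fun_prop)) (fun S e e' he he' => (hrel' S e e' he he').2)
    (lo := 0) (hi := max K 1) (by positivity)
    (fun e he => ⟨(lms_jump_functional_bounds 0 e he).2.2.1,
      (lms_jump_functional_bounds 0 e he).2.2.2.trans hK1⟩)
  refine ⟨max K 1, by positivity, D, hDm, hDb, hDid, fun n => ?_⟩
  -- A
  obtain ⟨A, hAm, hAb, hAid⟩ := exists_measurable_functional (δ := δ) (fun e : LData => ((1 / (2 * (n : ℝ) + 1)) * ∑ m ∈ Finset.Icc (-(n : ℤ)) n, (inLayerInteraction lennardJones e.2.1 + ∑' m' : ℤ, if m' = m then (0 : ℝ) else layerInteraction lennardJones e.2.1 (e.2.2.2 m' - e.2.2.2 m) (haggLabel e.2.2.1 m' - haggLabel e.2.2.1 m) 1)))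
    (continuousOn_const.mul (continuousOn_finsetSum _ fun m _ => lms_continuousOn_LE m))
    (fun S e e' he he' => ((hrel' S e e' he he').1 n).1)
    (lo := -max K 1) (hi := max K 1) (by linarith)
    (fun e he => abs_le.1 ((hK n e he).2.1.trans hKK))
  -- B
  obtain ⟨B, hBm, hBb, hBid⟩ := exists_measurable_functional (δ := δ) (fun e : LData => (∑ m ∈ Finset.Icc (-((n + 1 : ℕ) : ℤ)) ((n + 1 : ℕ) : ℤ), ((1 / (2 * (2 * (n : ℝ) + 1))) * ((if m ∈ Finset.Icc (-(n : ℤ) + 1) ((n : ℤ) + 1) then (1 : ℝ) else 0) + (if m ∈ Finset.Icc (-(n : ℤ) - 1) ((n : ℤ) - 1) then (1 : ℝ) else 0))) * (inLayerInteraction lennardJones e.2.1 + ∑' m' : ℤ, if m' = m then (0 : ℝ) else layerInteraction lennardJones e.2.1 (e.2.2.2 m' - e.2.2.2 m) (haggLabel e.2.2.1 m' - haggLabel e.2.2.1 m) 1)))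
    (continuousOn_finsetSum _ fun m _ => continuousOn_const.mul (lms_continuousOn_LE m))
    (fun S e e' he he' => ((hrel' S e e' he he').1 n).2.1)
    (lo := -max K 1) (hi := max K 1) (by linarith)
    (fun e he => abs_le.1 ((hK n e he).2.2.trans hKK))
  -- V
  obtain ⟨V, hVm, hVb, hVid⟩ := exists_measurable_functional (δ := δ) (fun e : LData => ((1 / (2 * (n : ℝ) + 1)) * (∑ l ∈ Finset.range (2 * n), ((e.2.2.2 ((-(n : ℤ) + l) + 1) - e.2.2.2 (-(n : ℤ) + l)) - (e.2.2.2 ((-(n : ℤ) + l) + 2) - e.2.2.2 ((-(n : ℤ) + l) + 1))) ^ 2 + ∑ l ∈ Finset.range (2 * n), ((e.2.2.2 ((-(n : ℤ) - 1 + l) + 1) - e.2.2.2 (-(n : ℤ) - 1 + l)) - (e.2.2.2 ((-(n : ℤ) - 1 + l) + 2) - e.2.2.2 ((-(n : ℤ) - 1 + l) + 1))) ^ 2)))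
    (Continuous.continuousOn (by fun_prop)) (fun S e e' he he' => ((hrel' S e e' he he').1 n).2.2.1)
    (lo := 0) (hi := max K 1) (by positivity)
    (fun e he => ⟨(lms_jump_functional_bounds n e he).1.1,
      (lms_jump_functional_bounds n e he).1.2.trans hK1⟩)
  -- Dt
  obtain ⟨Dt, hDtm, hDtb, hDtid⟩ := exists_measurable_functional (δ := δ) (fun e : LData => ((1 / (2 * (n : ℝ) + 1)) * ∑ m ∈ Finset.Icc (-(n : ℤ)) n, (((e.2.2.2 (m + 1) - e.2.2.2 m) - (e.2.2.2 (m + 2) - e.2.2.2 (m + 1))) ^ 2 + ((e.2.2.2 (m - 1) - e.2.2.2 (m - 2)) - (e.2.2.2 m - e.2.2.2 (m - 1))) ^ 2)))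
    (Continuous.continuousOn (by fun_prop)) (fun S e e' he he' => ((hrel' S e e' he he').1 n).2.2.2)
    (lo := 0) (hi := max K 1) (by positivity)
    (fun e he => ⟨(lms_jump_functional_bounds n e he).2.1.1,
      (lms_jump_functional_bounds n e he).2.1.2.trans hK1⟩)
  exact ⟨A, B, V, Dt, hAm, hBm, hVm, hDtm, fun μ => abs_le.2 (hAb μ), fun μ => abs_le.2 (hBb μ), hVb, hDtb,
    fun S e h0 hsep he => ⟨hAid S e h0 hsep he, hBid S e h0 hsep he, hVid S e h0 hsep he, hDtid S e h0 hsep he⟩⟩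

end Summit.AtomisticToContinuum.Crystallization.Theorems.SlackRigidityPricedFloorsIncrIdent

end
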